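import Mathlib
import HarnessLib
import Summits.HubbardSuperconductivity.HubbardSuperconductivity.Theorems.KLProgrammeKLRegimeVolumeLimitBoundGlueTwoPoint
import Summits.HubbardSuperconductivity.HubbardSuperconductivity.Theorems.KLProgrammeKLRegimeTwoPointAssemblyStubAsmPartition

/-!
# Child `KLRegimeVolumeLimitV12` (stmt-HubbardSuperconductivity-19858), stub `stub_vl_bound` — third glue: the supplier-shaped form.
# (Z1) is weakened to «pointwise-in-time limit + M-uniform sup bound» of the word six-point NUMERATOR (dominated convergence), and the
# partition-function limit is discharged from the tree (seat hubbard-kl-k3c5-p3, «OS-positivity-free direct assembly»)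

`…VolumeLimitBoundGlueTwoPoint` closes `stub_vl_bound` from (Z1) (L¹(du)-convergence of `S_M(z,·) = ∫e^{−V_M}·sixPointWord L M β 0 1 z ·`, the limit
`D_M → D∞ ≠ 0`) and the per-label two-point limits (H2pt).  Here:
* `D_M → e^{−βUL²/4}·Z_U/Z₀ ≠ 0` is t2's `tendsto_effPartitionFn_hubbard_eq_partitionFn_div_allU` (+ `Matrix.partitionFn_pos`), so it leaves the
  hypothesis list (`bare_partitionFn_limit`);
* the L¹(du) convergence follows by DOMINATED CONVERGENCE from what t2's all-`U` machine natively outputs for a word: a pointwise limit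
  `S_M(z,u) → S∞ z u` for `u ∈ [0, β)` and an `M`-eventual sup bound `‖S_M(z,u)‖ ≤ C` on `[0, β]` (`l1_tendsto_of_pointwise_dominated`; the limit
  is then automatically interval-integrable).
Result `stub_vl_bound_of_pointwise_twoPoint`: the registered stub text verbatim from, for every `β > 0`, `U`, `μ`, `L ≥ 3`:
(P) pointwise limits + sup bound of the word six-point numerator, and (H2pt) per-label limits of the bare spin-`↑` carrier bounded by `BH β U μ`.
Everything is proved; no definition.
-/

noncomputable section

namespace Summit.HubbardSuperconductivity.HubbardSuperconductivity.Theorems.TwoPointAssembly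

set_option linter.dupNamespace false -- summit = problem name (single-conjunct summit), D-0017

open Finset Filter Topology MeasureTheory intervalIntegral Literature.MathematicalPhysics.QuantumLattice Literature.Probability.LatticeModels
  GrassmannAlgebra
open Summit.HubbardSuperconductivity.HubbardSuperconductivity.Theorems.KLRegimeSplit
open Summit.HubbardSuperconductivity.HubbardSuperconductivity.Theorems.KLProgrammeLegKernels
open scoped ComplexConjugate ComplexOrder

variable {L M : ℕ} [NeZero L]

/-! ## §1 The partition-function limit (tree) -/

/-- **The bare normalised partition functions converge to a NON-ZERO limit** (t2, every `U`; `L ≥ 3`, `β > 0`). -/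
theorem bare_partitionFn_limit (hL : 3 ≤ L) {β : ℝ} (hβ : 0 < β) (U μ : ℝ) :
    ∃ Dinf : ℂ, Dinf ≠ 0 ∧
      Tendsto (fun M : ℕ => effPartitionFn ℂ (hubbardCovariance L M β μ 0) (hubbardInteraction L M β U)) atTop (𝓝 Dinf) := by
  haveI : Nonempty (Finset (Orb (FermionTorus 2 L))) := ⟨∅⟩
  have hZ' : Matrix.partitionFn β (hubbardTorusWith 2 L 1 U (μ + U / 2)) ≠ 0 :=
    (Matrix.partitionFn_pos β (isHermitian_hamiltonianWith (fermionTorusGraph 2 L) 1 U (μ + U / 2))).ne'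
  have hZ₀ : Matrix.partitionFn β (hubbardTorusWith 2 L 1 0 μ) ≠ 0 :=
    (Matrix.partitionFn_pos β (isHermitian_hamiltonianWith (fermionTorusGraph 2 L) 1 0 μ)).ne'
  have he : ((Real.exp (-(β * U / 4 * (L : ℝ) ^ 2)) : ℝ) : ℂ) ≠ 0 := by exact_mod_cast (Real.exp_pos _).ne'
  exact ⟨_, div_ne_zero (mul_ne_zero he hZ') hZ₀, MatsubaraAllU.tendsto_effPartitionFn_hubbard_eq_partitionFn_div_allU hL hβ μ U⟩

/-! ## §2 Dominated convergence: pointwise limit + sup bound ⟹ L¹(du) convergence on `[0, β]` -/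

omit [NeZero L] in
/-- **L¹ convergence on `[0,β]` from a pointwise limit on `[0,β)` and an eventual sup bound** (for a sequence of CONTINUOUS functions): the limit is
interval-integrable and `∫₀^β ‖F_M − f‖ → 0`. -/
theorem l1_tendsto_of_pointwise_dominated {β : ℝ} (hβ : 0 < β) (F : ℕ → ℝ → ℂ) (f : ℝ → ℂ) (hc : ∀ M, Continuous (F M))
    (hpt : ∀ u ∈ Set.Ico (0 : ℝ) β, Tendsto (fun M => F M u) atTop (𝓝 (f u)))
    {C : ℝ} (hbd : ∀ᶠ M : ℕ in atTop, ∀ u ∈ Set.Icc (0 : ℝ) β, ‖F M u‖ ≤ C) :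
    IntervalIntegrable f volume 0 β ∧ Tendsto (fun M => ∫ u in (0 : ℝ)..β, ‖F M u - f u‖) atTop (𝓝 0) := by
  have hI : Set.uIoc (0 : ℝ) β = Set.Ioc 0 β := Set.uIoc_of_le hβ.le
  -- a.e. on `Ι 0 β` the pointwise limit holds (it fails at most at `u = β`)
  have hae : ∀ᵐ u : ℝ ∂volume, u ∈ Set.uIoc (0 : ℝ) β → Tendsto (fun M => F M u) atTop (𝓝 (f u)) := by
    have hnull : volume ({β} : Set ℝ) = 0 := measure_singleton β
    refine (ae_iff.2 (measure_mono_null (fun u hu => ?_) hnull))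
    simp only [Set.mem_setOf_eq, Classical.not_imp] at hu
    obtain ⟨hu1, hu2⟩ := hu
    rw [hI] at hu1
    by_contra hne
    exact hu2 (hpt u ⟨hu1.1.le, lt_of_le_of_ne hu1.2 hne⟩)
  have haeR : ∀ᵐ u : ℝ ∂(volume.restrict (Set.uIoc (0 : ℝ) β)), Tendsto (fun M => F M u) atTop (𝓝 (f u)) :=
    (ae_restrict_iff' measurableSet_uIoc).2 hae
  -- measurability of the limit on the interval
  have hmeas : AEStronglyMeasurable f (volume.restrict (Set.uIoc (0 : ℝ) β)) :=
    aestronglyMeasurable_of_tendsto_ae atTop (fun M => (hc M).aestronglyMeasurable) haeR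
  -- the limit is bounded by `C` a.e.
  have hfbd : ∀ᵐ u : ℝ ∂(volume.restrict (Set.uIoc (0 : ℝ) β)), ‖f u‖ ≤ C := by
    have hbdR : ∀ᶠ M : ℕ in atTop, ∀ u ∈ Set.uIoc (0 : ℝ) β, ‖F M u‖ ≤ C := by
      filter_upwards [hbd] with M hM u hu
      rw [hI] at hu
      exact hM u ⟨hu.1.le, hu.2⟩
    filter_upwards [haeR, ae_restrict_mem measurableSet_uIoc] with u hu hmem
    exact le_of_tendsto hu.norm (hbdR.mono fun M hM => hM u hmem)
  have hint : IntervalIntegrable f volume 0 β := by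
    rw [intervalIntegrable_iff]
    exact Integrable.mono' (g := fun _ => C) ((intervalIntegrable_iff.1 intervalIntegrable_const)) hmeas hfbd
  refine ⟨hint, ?_⟩
  -- dominated convergence for `‖F_M − f‖` with the bound `2C`... via `C + C`
  have h := intervalIntegral.tendsto_integral_filter_of_dominated_convergence (μ := volume) (a := 0) (b := β) (l := atTop)
    (F := fun M u => ‖F M u - f u‖) (f := fun _ => (0 : ℝ)) (fun _ => C + C) ?_ ?_ intervalIntegrable_const ?_
  · simpa using h
  · exact Filter.Eventually.of_forall fun M => (((hc M).aestronglyMeasurable).sub hmeas).norm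
  · have hbdR : ∀ᶠ M : ℕ in atTop, ∀ u ∈ Set.uIoc (0 : ℝ) β, ‖F M u‖ ≤ C := by
      filter_upwards [hbd] with M hM u hu
      rw [hI] at hu
      exact hM u ⟨hu.1.le, hu.2⟩
    have hfbd' : ∀ᵐ u : ℝ ∂volume, u ∈ Set.uIoc (0 : ℝ) β → ‖f u‖ ≤ C := (ae_restrict_iff' measurableSet_uIoc).1 hfbd
    filter_upwards [hbdR] with M hM
    filter_upwards [hfbd'] with u hu hmem
    rw [Real.norm_eq_abs, abs_norm]
    exact (norm_sub_le _ _).trans (add_le_add (hM u hmem) (hu hmem))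
  · filter_upwards [hae] with u hu hmem
    have := ((hu hmem).sub_const (f u)).norm
    simpa using this

/-! ## §3 `stub_vl_bound` from pointwise word limits and per-label two-point limits -/

/-- **`stub_vl_bound` FROM THE SUPPLIER-SHAPED INPUTS.**  For every `β > 0`, `U`, `μ`, `L ≥ 3`: (P) a pointwise-in-`u ∈ [0,β)` limit of the word
six-point numerator `∫dμ_{C_M}e^{−V}·sixPointWord L M β 0 1 z u` for every torus site, with an `M`-eventual sup bound on `[0,β]` uniform in `z`; and
(H2pt) per-label limits of the bare spin-`↑` carrier bounded by `BH β U μ` (uniform in `L`).  Then the registered stub text holds verbatim. -/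
theorem stub_vl_bound_of_pointwise_twoPoint (BH : ℝ → ℝ → ℝ → ℝ)
    (hZ : ∀ β : ℝ, 0 < β → ∀ (U μ : ℝ) (L : ℕ) [NeZero L], 3 ≤ L →
      (∃ (Sinf : TorusSite 2 L → ℝ → ℂ) (C : ℝ),
        (∀ z : TorusSite 2 L, ∀ u ∈ Set.Ico (0 : ℝ) β, Tendsto (fun M : ℕ =>
          gaussExpect ℂ (hubbardCovariance L M β μ 0) (grassmannExp (-(hubbardInteraction L M β U)) * sixPointWord L M β 0 1 z u))
            atTop (𝓝 (Sinf z u))) ∧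
        (∀ᶠ M : ℕ in atTop, ∀ (z : TorusSite 2 L), ∀ u ∈ Set.Icc (0 : ℝ) β,
          ‖gaussExpect ℂ (hubbardCovariance L M β μ 0) (grassmannExp (-(hubbardInteraction L M β U)) * sixPointWord L M β 0 1 z u)‖ ≤ C)) ∧
      (∀ (n : ℤ) (p : TorusSite 2 L), ∃ σH : ℂ, ‖σH‖ ≤ BH β U μ ∧ ∀ ε : ℝ, 0 < ε → ∃ M₁ : ℕ, ∀ M : ℕ, M₁ ≤ M →
        ∀ ω : MatsubaraIdx M, matsubaraInt M ω = n → ‖klSelfEnergy L M β U μ 0 klE0 (nScales β + 1) (ω, p) 0 - σH‖ ≤ ε)) :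
    ∀ (G : GeoConsts) (P : SplitConsts) (Q : EngConsts) (R : RenConsts), G.WF → P.WF → Q.WF → R.WF →
      ∃ c₅ : ℝ, 0 < c₅ ∧ ∀ c : ℝ, 0 < c → c ≤ c₅ → ∃ U₀ : ℝ, 0 < U₀ ∧
        ∀ μ ∈ klWindowC, ∀ U : ℝ, 0 < U → U ≤ U₀ → ∀ β : ℝ, klBetaMin ≤ β → β ≤ Real.exp (c / U ^ 2) →
          ∀ K : TrigPolyC4v, klPredsV12.frameOK R U (nScales β) μ K →
            ∀ (Lstar : ℕ) (Mstar : ℕ → ℕ), TowerP klPredsV12 G P Q R β U μ K Lstar Mstar →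
              ∃ B : ℝ, ∃ L₀ : ℕ, ∃ Mth : ℕ → ℕ, ∀ (L : ℕ) [NeZero L], L₀ ≤ L → ∀ (M : ℕ) [NeZero M], Mth L ≤ M →
                ∀ (k : FreqMomentum L M) (σ : Fin 2), ‖klSelfEnergy L M β U μ K klE0 (nScales β + 1) k σ‖ ≤ B := by
  refine stub_vl_bound_of_Z1_twoPoint BH fun β hβ U μ L _ hL => ?_
  obtain ⟨⟨Sinf, C, hpt, hbd⟩, h2⟩ := hZ β hβ U μ L hL
  obtain ⟨Dinf, hDinf, hD⟩ := bare_partitionFn_limit (L := L) hL hβ U μ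
  have hz : ∀ z : TorusSite 2 L, IntervalIntegrable (Sinf z) volume 0 β ∧
      Tendsto (fun M : ℕ => ∫ u in (0 : ℝ)..β,
        ‖gaussExpect ℂ (hubbardCovariance L M β μ 0) (grassmannExp (-(hubbardInteraction L M β U)) * sixPointWord L M β 0 1 z u) -
          Sinf z u‖) atTop (𝓝 0) := fun z =>
    l1_tendsto_of_pointwise_dominated hβ (fun M u => gaussExpect ℂ (hubbardCovariance L M β μ 0)
        (grassmannExp (-(hubbardInteraction L M β U)) * sixPointWord L M β 0 1 z u)) (Sinf z)
      (fun M => continuous_wordSixPoint_up (L := L) (M := M) β U μ z) (hpt z) (hbd.mono fun M hM => hM z)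
  exact ⟨Sinf, Dinf, hDinf, fun z => (hz z).1, hD, fun z => (hz z).2, h2⟩

end Summit.HubbardSuperconductivity.HubbardSuperconductivity.Theorems.TwoPointAssembly

end
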